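import Mathlib
import Summits.ResolutionOfSingularities.ResolutionOfSingularities.Theses.Valuative

/-!
# Sketch — first lemmas of the crux idea cards for `Valuative.LuAlphaPTorsor` (stmt-0641)

Planner sketch (crux-ideate round 1, ideator 3). Nothing here is proved; each `def … : Prop`
is the First lemma of one idea card, stated over Mathlib with the crux's own binders, and must
only ELABORATE.

Notation in comments: `S := (A₀)_𝔭₀ = Localization.AtPrime 𝔭₀`, `𝔭₀ = m_O ∩ A₀` the centre,
`a := t ^ p ∈ A₀`, `𝔪 := maximalIdeal S`.
-/

namespace Summit.ResolutionOfSingularities.ResolutionOfSingularities.Cruxes.LuAlphaPTorsor.Sketch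

open IsLocalRing

/-- Card `ostrowski-typed-exits`, First lemma (EXIT CRITERION = the terminal step of every exit):
with the crux's data, IF the radicand `a = t^p` is not a `p`-th power plus an element of `𝔪²`
in the regular local ring `S = (A₀)_𝔭₀` of the centre (equivalently: `S[T]/(T^p - a)` is a
regular local ring; equivalently `da ≠ 0` in `Ω_S ⊗ κ` or `ā ∉ κ^p`), THEN the crux's conclusion
holds with `A := A₀[t]`. Paper proof: `S[T]/(T^p-a)` is local (one prime over `𝔪`), its maximal
ideal is `(𝔪, T - s)` resp. `𝔪·S[T]`, and it is generated by `dim S` elements iff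
`a - s^p ∉ 𝔪²` for all `s`; `t ∈ O` because `O` is integrally closed; `A₀[t] ≅ A₀[T]/(T^p-a)`
(monic division) localises at the centre to `S[T]/(T^p-a)`. The hypothesis forces `t ∉ Frac A₀`. -/
def ExitCriterion : Prop :=
  ∀ p : ℕ, p.Prime → ∀ (k K : Type) [Field k] [CharP k p] [Field K] [Algebra k K]
    (O : ValuationSubring K) (A₀ : Subalgebra k K) (h₀ : A₀.toSubring ≤ O.toSubring) (t : K)
    (ht : t ^ p ∈ A₀), A₀.FG →
    IsFractionRing (Algebra.adjoin k (insert t (A₀ : Set K))) K →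
    IsRegularLocalRing (Localization.AtPrime
      (Ideal.comap (Subring.inclusion h₀) (IsLocalRing.maximalIdeal O))) →
    (∀ s : Localization.AtPrime (Ideal.comap (Subring.inclusion h₀) (IsLocalRing.maximalIdeal O)),
      algebraMap A₀.toSubring
          (Localization.AtPrime (Ideal.comap (Subring.inclusion h₀) (IsLocalRing.maximalIdeal O)))
          ⟨t ^ p, ht⟩ - s ^ p ∉
        (IsLocalRing.maximalIdeal (Localization.AtPrime
          (Ideal.comap (Subring.inclusion h₀) (IsLocalRing.maximalIdeal O)))) ^ 2) →
    ∃ (A : Subalgebra k K) (h : A.toSubring ≤ O.toSubring), A₀ ≤ A ∧ t ∈ A ∧ A.FG ∧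
      IsFractionRing A K ∧
      IsRegularLocalRing (Localization.AtPrime
        (Ideal.comap (Subring.inclusion h) (IsLocalRing.maximalIdeal O)))

/-- Card `restrict-to-the-exceptional-divisor`, First lemma (RESTRICTED CRITERION, one dimension
down): with the crux's data and a regular parameter `x` of `S = (A₀)_𝔭₀` (think: the local
equation of an exceptional prime divisor `E = V(x)` through the centre), IF the image `ā` of the
radicand in the regular local ring `S/xS = 𝒪_{E,centre}` is not a `p`-th power plus an element of
`𝔪̄²` — written without quotients as `a ∉ S^p + 𝔪² + x·S` — THEN the crux's conclusion holds
(indeed `a ∉ S^p + 𝔪²`, and `ExitCriterion` applies). The point of the card is the converse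
bookkeeping: regularity of the (n-1)-dimensional restricted torsor `{s^p = ā}` over `E` at the
centre implies regularity of the n-dimensional torsor there. -/
def RestrictedCriterion : Prop :=
  ∀ p : ℕ, p.Prime → ∀ (k K : Type) [Field k] [CharP k p] [Field K] [Algebra k K]
    (O : ValuationSubring K) (A₀ : Subalgebra k K) (h₀ : A₀.toSubring ≤ O.toSubring) (t : K)
    (ht : t ^ p ∈ A₀) (x : K) (hx : x ∈ A₀), A₀.FG →
    IsFractionRing (Algebra.adjoin k (insert t (A₀ : Set K))) K →
    IsRegularLocalRing (Localization.AtPrime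
      (Ideal.comap (Subring.inclusion h₀) (IsLocalRing.maximalIdeal O))) →
    algebraMap A₀.toSubring
        (Localization.AtPrime (Ideal.comap (Subring.inclusion h₀) (IsLocalRing.maximalIdeal O)))
        ⟨x, hx⟩ ∈
      IsLocalRing.maximalIdeal (Localization.AtPrime
        (Ideal.comap (Subring.inclusion h₀) (IsLocalRing.maximalIdeal O))) →
    algebraMap A₀.toSubring
        (Localization.AtPrime (Ideal.comap (Subring.inclusion h₀) (IsLocalRing.maximalIdeal O)))
        ⟨x, hx⟩ ∉
      (IsLocalRing.maximalIdeal (Localization.AtPrime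
        (Ideal.comap (Subring.inclusion h₀) (IsLocalRing.maximalIdeal O)))) ^ 2 →
    (∀ s m r : Localization.AtPrime (Ideal.comap (Subring.inclusion h₀) (IsLocalRing.maximalIdeal O)),
      m ∈ (IsLocalRing.maximalIdeal (Localization.AtPrime
          (Ideal.comap (Subring.inclusion h₀) (IsLocalRing.maximalIdeal O)))) ^ 2 →
      algebraMap A₀.toSubring
          (Localization.AtPrime (Ideal.comap (Subring.inclusion h₀) (IsLocalRing.maximalIdeal O)))
          ⟨t ^ p, ht⟩ ≠
        s ^ p + m +
          algebraMap A₀.toSubring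
            (Localization.AtPrime (Ideal.comap (Subring.inclusion h₀) (IsLocalRing.maximalIdeal O)))
            ⟨x, hx⟩ * r) →
    ∃ (A : Subalgebra k K) (h : A.toSubring ≤ O.toSubring), A₀ ≤ A ∧ t ∈ A ∧ A.FG ∧
      IsFractionRing A K ∧
      IsRegularLocalRing (Localization.AtPrime
        (Ideal.comap (Subring.inclusion h) (IsLocalRing.maximalIdeal O)))

/-- Sanity: the crux itself, referenced by name (the cards' lines must conclude THIS decl). -/
example : Prop := Summit.ResolutionOfSingularities.ResolutionOfSingularities.Theses.Valuative.LuAlphaPTorsor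

end Summit.ResolutionOfSingularities.ResolutionOfSingularities.Cruxes.LuAlphaPTorsor.Sketch
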